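import Summits.ABC.IUTFork.Conditional.Layer1OfS
import Summits.ABC.IUTFork.Conditional.Layer1OfSInhabited
import HarnessLib

/-!
# L1 layer certificate — honesty companion, v2: `Layer1Residual_v2` (and the v1 TOP binder `Layer1Residual`) are KERNEL-INHABITED

abc-iut cell, branch C «conditional verification abc ⇐ S» (rung LADDER-ABC:A2.C; director-abc (C2) layer certificates), PROOF-ONLY
companion of the CERT-L1 files of abc-iut-L1-d4 (gen 5): parts `Conditional/Layer1OfSa.lean` (v1 p429833 ✓, §v2 p434594 ✓),
`Layer1OfSb.lean` (p429996 ✓), `Layer1OfSbV2.lean` (p434604 ✓) and the TOP `Layer1OfS.lean` (v1 p430020 ✓, §v2 p434776 ✓: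
`Layer1Residual_v2 := Layer1ResidualA_v2 ∧ Layer1ResidualB` — the ONE binder the apex `Conditional/AbcOfS.lean` takes for layer L1
from now on, abc-iut-L1-lead R131 (6)), and of abc-iut-w6-d080's v1 honesty companion `Layer1OfSInhabited.lean` (p431922 ✓).
Seat abc-iut-w4-d100 (gen 7; RQ7 second read of p434776 WITH kernel probe, 2026-08-26T09:55Z; node id CERT-L1 / Conditional-L1).

WHAT IT SHOWS (the v2 twin of `layer1Residual_inhabited_parts`, in the grammar of abc-iut-w6-d071's `Layer2OfSV1.lean`):
* `layer1ResidualA_v2_inhabited : Layer1ResidualA_v2` — v1's seven index witnesses (via `layer1ResidualA_inhabited`) and the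
  index's `_holds` of the two re-keyed [FrdI] Def 3.1 (i)/(iv) claim-form siblings `N_FrdI_Def3_1_i'` / `N_FrdI_Def3_1_iv'`
  (`DAGRf.lean`, abc-iut-c312-2), BY NAME;
* `layer1Residual_v2_inhabited : Layer1Residual_v2` and `layer1Cone_v2_inhabited : Layer1ConeA_v2 ∧ Layer1ConeB_v2` — the whole
  v2 L1 slice of the Cor. 3.12 cone, AS INDEXED, is a kernel theorem outright (the top's `layer1Cone_v2_of` at the witness);
* `layer1Residual_inhabited : Layer1Residual`, `layer1Cone_inhabited` — the v1 statements in TOP form (p431922 stated them over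
  the parts, `Layer1ResidualA ∧ Layer1ResidualB`, because the top had not built yet; by `Iff.rfl` the same terms);
* version bridges `layer1ResidualA_of_v2`, `layer1Residual_of_v2` (v2 ⇒ v1: the v2 binder is the STRONGER hypothesis, so an
  apex consumer switching to v2 loses nothing), `layer1Residual_v2_of_v1`, `layer1Residual_v2_iff`
  (v2 ↔ v1 ∧ `N_FrdI_Def3_1_i'` ∧ `N_FrdI_Def3_1_iv'`);
* `layer1_census_v2` — the v2 COUNT LINE's arithmetic (176 = 90 + 18 + 67 + 0 + 1; A 84 = 43 + 9 + 32; B 92 = 47 + 9 + 35 + 1).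

READING (honest framing, as in p431922): «residual» in the CERT-L1 v2 count line is a plan/L1/NODES.md COVERAGE status of the
18 items (the layer lead's judgement on whether the named theorems exhaust the printed clauses — the two `_part` rows [FrdI]
Prop 2.2 (ii)/(iii) especially), NOT an open kernel obligation: the apex's L1 binder `(h1 : Layer1Residual_v2)` is dischargeable by
`layer1Residual_v2_inhabited`, so layer L1 contributes 0 open KERNEL obligations to `abc_of_S` at the index level also after the
re-key (inhabited ≠ lead-discharged; whether the apex keeps `h1` visible is the C lead's choice). Nothing is claimed about print
coverage or about [IUTchIII] Cor. 3.12. No `def`, nothing restated, no new Prop fact; universe names as in the parts.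
typed ≠ proved; indexed ≠ endorsed; no side taken; nothing here says abc is proved or refuted.
[claim: Mochizuki2012, status: disputed] (node texts)
-/

namespace Summit.ABC.IUTFork.Conditional

open Summit.ABC.IUTFork.DAG

universe u₁ u₂ u₃ u₄ u₅ u₆ u₇ u₈ u₉ u₁₀ u₁₁ u₁₂ u₁₃ u₁₄ u₁₅ u₁₆

/-! ### v2 residual: kernel-inhabited -/

/-- **The [FrdI] §1–§3 residual of the L1 certificate, v2, is kernel-inhabited**: its nine conjuncts are v1's seven (witnessed
BY NAME through abc-iut-w6-d080's `layer1ResidualA_inhabited`) and the re-keyed claim-form index Props of [FrdI] Def 3.1 (i)/(iv)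
(`N_FrdI_Def3_1_i'_holds`, `N_FrdI_Def3_1_iv'_holds`, `DAGRf`). Proves nothing new. [claim: Mochizuki2012, status: disputed] -/
theorem layer1ResidualA_v2_inhabited : Summit.ABC.IUTFork.Conditional.Layer1ResidualA_v2.{u₁, u₂, u₃, u₄, u₅} := by
  obtain ⟨h1, h2, h3, h4, h5, h6, h7⟩ := layer1ResidualA_inhabited.{u₁, u₂, u₃, u₄, u₅}
  exact ⟨h1, h2, h3, h4, h5, h6, h7, N_FrdI_Def3_1_i'_holds, N_FrdI_Def3_1_iv'_holds⟩

/-- **The v2 apex binder of layer L1 is kernel-inhabited**: `Layer1Residual_v2` (= `Layer1ResidualA_v2 ∧ Layer1ResidualB`,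
9 + 9 conjuncts) holds outright, so `(h1 : Layer1Residual_v2)` can be instantiated by this term. Inhabited ≠ lead-discharged.
[claim: Mochizuki2012, status: disputed] -/
theorem layer1Residual_v2_inhabited : Summit.ABC.IUTFork.Conditional.Layer1Residual_v2.{u₁, u₂, u₃, u₄, u₅} :=
  ⟨layer1ResidualA_v2_inhabited, layer1ResidualB_inhabited⟩

/-- **The [FrdI] §1–§3 slice of the L1 cone, v2, AS INDEXED, holds in the kernel** (`layer1ConeA_v2_of` at the witness).
[claim: Mochizuki2012, status: disputed] -/
theorem layer1ConeA_v2_inhabited : Summit.ABC.IUTFork.Conditional.Layer1ConeA_v2.{u₁, u₂, u₃, u₄, u₅} :=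
  layer1ConeA_v2_of layer1ResidualA_v2_inhabited

/-- **The [FrdI] §4–§6 + [FrdII] slice of the L1 cone, v2, AS INDEXED, holds in the kernel** (`layer1ConeB_v2_of` at
abc-iut-w6-d080's witness `layer1ResidualB_inhabited`; the residual of part B is unchanged in v2). [claim: Mochizuki2012, status: disputed] -/
theorem layer1ConeB_v2_inhabited :
    Summit.ABC.IUTFork.Conditional.Layer1ConeB_v2.{u₁, u₂, u₃, u₄, u₅, u₆, u₇, u₈, u₉, u₁₀, u₁₁, u₁₂, u₁₃, u₁₄, u₁₅, u₁₆} :=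
  layer1ConeB_v2_of layer1ResidualB_inhabited

/-- **The whole L1 slice of the [IUTchIII] Cor. 3.12 cone, v2, AT THE INDEX LEVEL, is a kernel theorem**: the conclusion of the
top's `layer1Cone_v2_of`, reached without its hypothesis. Index level ≠ print coverage; no NODES row moves; nothing about
Cor. 3.12 itself. [claim: Mochizuki2012, status: disputed] -/
theorem layer1Cone_v2_inhabited :
    Summit.ABC.IUTFork.Conditional.Layer1ConeA_v2.{u₁, u₂, u₃, u₄, u₅} ∧
      Summit.ABC.IUTFork.Conditional.Layer1ConeB_v2.{u₁, u₂, u₃, u₄, u₅, u₆, u₇, u₈, u₉, u₁₀, u₁₁, u₁₂, u₁₃, u₁₄, u₁₅, u₁₆} :=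
  layer1Cone_v2_of layer1Residual_v2_inhabited

/-! ### v1 binder, TOP form (p431922 stated these over the parts before the top module built) -/

/-- **The v1 apex binder `Layer1Residual` of the TOP file holds outright** (abc-iut-w6-d080's `layer1Residual_inhabited_parts`, whose
type `Layer1ResidualA ∧ Layer1ResidualB` IS `Layer1Residual` by `Iff.rfl`). [claim: Mochizuki2012, status: disputed] -/
theorem layer1Residual_inhabited : Summit.ABC.IUTFork.Conditional.Layer1Residual.{u₁, u₂, u₃, u₄, u₅} :=
  layer1Residual_inhabited_parts

/-- **The whole v1 L1 slice via the TOP's `layer1Cone_of`** (same type as p431922's `layer1Cone_inhabited_parts`, reached through the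
top file). [claim: Mochizuki2012, status: disputed] -/
theorem layer1Cone_inhabited :
    Summit.ABC.IUTFork.Conditional.Layer1ConeA.{u₁, u₂, u₃, u₄, u₅} ∧
      Summit.ABC.IUTFork.Conditional.Layer1ConeB.{u₁, u₂, u₃, u₄, u₅, u₆, u₇, u₈, u₉, u₁₀, u₁₁, u₁₂, u₁₃, u₁₄, u₁₅, u₁₆} :=
  layer1Cone_of layer1Residual_inhabited

/-! ### Version bridges v1 ↔ v2 (spec §3: a later certificate version never adds an UNNAMED hypothesis) -/

/-- v2's part-A residual implies v1's: v1's seven conjuncts are literally the first seven of v2's nine (projection).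
[claim: Mochizuki2012, status: disputed] -/
theorem layer1ResidualA_of_v2 (h : Summit.ABC.IUTFork.Conditional.Layer1ResidualA_v2.{u₁, u₂, u₃, u₄, u₅}) :
    Summit.ABC.IUTFork.Conditional.Layer1ResidualA.{u₁, u₂, u₃, u₄, u₅} :=
  ⟨h.1, h.2.1, h.2.2.1, h.2.2.2.1, h.2.2.2.2.1, h.2.2.2.2.2.1, h.2.2.2.2.2.2.1⟩

/-- **The v2 binder implies the v1 binder** (`Layer1Residual_v2 → Layer1Residual`): v2 is the STRONGER hypothesis — it ADDS the two
NAMED index Props `N_FrdI_Def3_1_i'`, `N_FrdI_Def3_1_iv'` and removes nothing — so an apex consumer that switches its L1 binder from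
v1 to v2 still obtains everything v1 gave (`layer1Cone_of ∘ layer1Residual_of_v2`). [claim: Mochizuki2012, status: disputed] -/
theorem layer1Residual_of_v2 (h : Summit.ABC.IUTFork.Conditional.Layer1Residual_v2.{u₁, u₂, u₃, u₄, u₅}) :
    Summit.ABC.IUTFork.Conditional.Layer1Residual.{u₁, u₂, u₃, u₄, u₅} :=
  ⟨layer1ResidualA_of_v2 h.1, h.2⟩

/-- Conversely, v1's binder together with the two re-keyed [FrdI] Def 3.1 (i)/(iv) claim-form index Props gives v2's.
[claim: Mochizuki2012, status: disputed] -/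
theorem layer1Residual_v2_of_v1 (h : Summit.ABC.IUTFork.Conditional.Layer1Residual.{u₁, u₂, u₃, u₄, u₅})
    (hi : N_FrdI_Def3_1_i'.{u₁, u₂}) (hiv : N_FrdI_Def3_1_iv'.{u₁, u₂, u₃, u₄, u₅}) :
    Summit.ABC.IUTFork.Conditional.Layer1Residual_v2.{u₁, u₂, u₃, u₄, u₅} :=
  ⟨⟨h.1.1, h.1.2.1, h.1.2.2.1, h.1.2.2.2.1, h.1.2.2.2.2.1, h.1.2.2.2.2.2.1, h.1.2.2.2.2.2.2, hi, hiv⟩, h.2⟩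

/-- **v2 ↔ v1 ∧ the two named additions**: `Layer1Residual_v2 ↔ Layer1Residual ∧ N_FrdI_Def3_1_i' ∧ N_FrdI_Def3_1_iv'` — the exact
delta of the re-key, for the C scoreboard's binder bookkeeping. [claim: Mochizuki2012, status: disputed] -/
theorem layer1Residual_v2_iff :
    Summit.ABC.IUTFork.Conditional.Layer1Residual_v2.{u₁, u₂, u₃, u₄, u₅} ↔
      (Summit.ABC.IUTFork.Conditional.Layer1Residual.{u₁, u₂, u₃, u₄, u₅} ∧ N_FrdI_Def3_1_i'.{u₁, u₂} ∧
        N_FrdI_Def3_1_iv'.{u₁, u₂, u₃, u₄, u₅}) :=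
  ⟨fun h => ⟨layer1Residual_of_v2 h, h.1.2.2.2.2.2.2.2.1, h.1.2.2.2.2.2.2.2.2⟩,
    fun h => layer1Residual_v2_of_v1 h.1 h.2.1 h.2.2⟩

/-! ### Count-line arithmetic of CERT-L1 v2 (bookkeeping only) -/

/-- The v2 COUNT LINE of `Conditional/Layer1OfS.lean` §v2 adds up: Discharged 90 = A 43 + B 47; Residual 18 = A 9 + B 9;
d_data 67 = A 32 + B 35; L1 cone 176 = 90 + 18 + 67 + findings 0 + refuted-as-typed 1; per part A 84 = 43 + 9 + 32 + 0 and
B 92 = 47 + 9 + 35 + 1. Arithmetic only — no node status is asserted. [claim: Mochizuki2012, status: disputed] -/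
theorem layer1_census_v2 :
    (43 + 47 : ℕ) = 90 ∧ (9 + 9 : ℕ) = 18 ∧ (32 + 35 : ℕ) = 67 ∧ (90 + 18 + 67 + 0 + 1 : ℕ) = 176 ∧
      (43 + 9 + 32 + 0 : ℕ) = 84 ∧ (47 + 9 + 35 + 1 : ℕ) = 92 :=
  ⟨rfl, rfl, rfl, rfl, rfl, rfl⟩

end Summit.ABC.IUTFork.Conditional
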